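import Summits.BirchSwinnertonDyer.BirchSwinnertonDyer.Theorems.SylvesterTwoHeegnerIndexCoupledDescentCebotarevHSYFree
import Literature.NumberTheory.EllipticCurves.HuShuYin2019.SylvesterPairKummerIndependence
import Summits.BirchSwinnertonDyer.Rank1Residual.X12.CubeSumFamilies
import HarnessLib

/-!
# (hL3a)/(hL3b) at `p = 2` for THE Sylvester pair `(E_{3p²}, E_p)` — arithmetic discharged

The composition announced as OFFER #12 (bsd-cm STATUS): the binder-free Čebotarev clauses
`SylvesterTwoCoupledDescentCebotarev.infinite_kolyvaginPrimes_ne_hsy'` /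
`exists_cmH1_infinite_kolyvaginPrimes_line_hsy` (`…CoupledDescentCebotarevHSYFree`, leaf (L3) of
VARIANT K for crux `UpperOffV0HSYPlus`, stmt-BirchSwinnertonDyer-19804) SPECIALISED to the pair of
short models `A = cubeSumCurve (3p²) = E_{3p²} : y² = x³ − 432·9p⁴`, `B = cubeSumCurve p = E_p :
y² = x³ − 432p²` over `K = ℚ(ω)` (`ω² + ω + 1 = 0`, `[K : ℚ] = 2`), `p` a prime `≡ 1 (mod 3)`, with
the four displayed arithmetic hypotheses DISCHARGED BY NAME from k-ty1's
`HuShuYin2019.SylvesterPairKummerIndependence`: «`t³ + a₆ ≠ 0` on `K`» for both curves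
(`forall_pow_three_add_algebraMap_a₆_three_mul_sq_ne_zero`, `…_ne_zero_of_prime`: `∛(18p)`,
`∛(4p) ∉ ℚ(ω)`) and the two Kummer-independence clauses
(`pow_three_add_a₆_ne_zero_of_mem_adjoin_of_prime` / `_of_three_mul_sq`: `∛(18p) ∉ K(∛(4p))` and
conversely). RESULT: (hL3a) for the Sylvester pair with NOTHING displayed but the levels
`N_A, N_B`; (hL3b) with only the bottom-class data (C4) and the levels displayed; both also
keyed on the route's `p % 9 = 4 ∨ p % 9 = 7` (`…_of_mod_nine`). The curves being elliptic comes
from `Rank1Residual.X12.CubeSumFamilies.isElliptic_cubeSumCurve`. Theorem-only; nothing asserted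
on 19804; no label moves; BSD not claimed for any curve.
-/

set_option linter.dupNamespace false -- Summits modules are `Summit.<Summit>.<Problem>…` by design

noncomputable section

open scoped Classical
open WeierstrassCurve NumberField IsDedekindDomain Field
open Literature.NumberTheory.EllipticCurves Literature.NumberTheory.GaloisRepresentations
open Literature.NumberTheory.EllipticCurves.HuShuYin2019

namespace Summit.BirchSwinnertonDyer.BirchSwinnertonDyer.Theorems.SylvesterTwoCoupledDescentCebotarev

variable {K : Type} [Field K] [NumberField K]

/-- **(hL3a) at `p = 2` for the Sylvester pair `(A, B) = (E_{3p²}, E_p)` over `K = ℚ(ω)`**, `p` a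
prime `≡ 1 (mod 3)`: for all classes `s ∈ H¹(K, A_K[2])`, `t ∈ H¹(K, B_K[2])`, infinitely many
Kolyvagin primes `ℓ` (`ℓ ∤ N_A N_B d_K`, `ℓ ≠ 2`, `(ℓ)` prime in `𝓞 K`, `Frob ℓ = Frob ∞` on both
`2`-division fields) with `s_λ ≠ 0` if `s ≠ 0` and `t_λ ≠ 0` if `t ≠ 0`. Nothing displayed but the
levels. (`infinite_kolyvaginPrimes_ne_hsy'` + k-ty1's four cube-root facts.) -/
theorem infinite_kolyvaginPrimes_ne_sylvesterPair {ω : K} (hω : ω ^ 2 + ω + 1 = 0)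
    (h2 : Module.finrank ℚ K = 2) {p : ℕ} (hp : p.Prime) (hp3 : p % 3 = 1)
    {NA NB : ℕ} [NeZero NA] [NeZero NB]
    (s : galH1Torsion ((cubeSumCurve (3 * (p : ℚ) ^ 2)).baseChange K) ((2 : ℕ) : ℤ))
    (t : galH1Torsion ((cubeSumCurve (p : ℚ)).baseChange K) ((2 : ℕ) : ℤ)) :
    Set.Infinite {ℓ : ℕ | (ℓ.Prime ∧ ¬ ℓ ∣ NA ∧ ¬ ℓ ∣ NB ∧ ¬ ((ℓ : ℤ) ∣ NumberField.discr K) ∧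
        ℓ ≠ 2 ∧ (Ideal.span {(ℓ : 𝓞 K)}).IsPrime ∧
        FrobEqFrobInfty (cubeSumCurve (3 * (p : ℚ) ^ 2)) K 2 ℓ ∧
        FrobEqFrobInfty (cubeSumCurve (p : ℚ)) K 2 ℓ) ∧
      ∀ v : HeightOneSpectrum (𝓞 K), (ℓ : 𝓞 K) ∈ v.asIdeal →
        (s ≠ 0 → s ∉ ((cubeSumCurve (3 * (p : ℚ) ^ 2)).baseChange K).torsionLocalKer
          (v.adicCompletion K) ((2 : ℕ) : ℤ)) ∧
        (t ≠ 0 → t ∉ ((cubeSumCurve (p : ℚ)).baseChange K).torsionLocalKer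
          (v.adicCompletion K) ((2 : ℕ) : ℤ))} := by
  have hp0 : (p : ℚ) ≠ 0 := by exact_mod_cast hp.ne_zero
  have hp2 : p ≠ 2 := by rintro rfl; norm_num at hp3
  haveI := Rank1Residual.X12.CubeSumFamilies.isElliptic_cubeSumCurve hp0
  haveI := Rank1Residual.X12.CubeSumFamilies.isElliptic_cubeSumCurve
    (mul_ne_zero (by norm_num) (pow_ne_zero 2 hp0) : (3 * (p : ℚ) ^ 2) ≠ 0)
  exact infinite_kolyvaginPrimes_ne_hsy' (JZero.isImaginaryQuadratic_of_sq_add_self_add_one hω h2)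
    (JZero.exists_aut_apply_eq_sq K hω h2).1 rfl rfl rfl rfl
    (forall_pow_three_add_algebraMap_a₆_three_mul_sq_ne_zero hω h2 hp hp2)
    (pow_three_add_a₆_ne_zero_of_mem_adjoin_of_prime hω h2 hp hp3) rfl rfl rfl rfl
    (forall_pow_three_add_algebraMap_a₆_ne_zero_of_prime hω h2 hp hp2)
    (pow_three_add_a₆_ne_zero_of_mem_adjoin_of_three_mul_sq hω h2 hp hp3) s t

/-- **(hL3b) at `p = 2` for the Sylvester pair `(A, B) = (E_{3p²}, E_p)` over `K = ℚ(ω)`**, package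
form: there are `[ω]`-data `φB / fnB / hfnB` on `B_K = E_p ⁄ K` (characterised: `φB² + φB + 1 = 0`,
`φB (x, y) = (ω² x, y)`, `↑(fnB P) = φB ↑P`) such that, for `wH := H¹(fnB)`, every bottom class `y`
with a `c`-fixed generator `x₁` of its `𝔽₄`-line (C4), every `s` off that line and every
`cl ≠ 0` in `H¹(K, A_K[2])`: infinitely many Kolyvagin primes with `y_λ = 0`, `s_λ ≠ 0`,
`cl_λ ≠ 0`. Displayed: the conjugation `c` (`c ω = ω²`), (C4), the levels. -/
theorem exists_cmH1_infinite_kolyvaginPrimes_line_sylvesterPair {ω : K} (hω : ω ^ 2 + ω + 1 = 0)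
    (h2 : Module.finrank ℚ K = 2) {p : ℕ} (hp : p.Prime) (hp3 : p % 3 = 1)
    {c : K ≃ₐ[ℚ] K} (hcω : c ω = ω ^ 2) {NA NB : ℕ} [NeZero NA] [NeZero NB] :
    ∃ (φB : geomPoints ((cubeSumCurve (p : ℚ)).baseChange K) →+
        geomPoints ((cubeSumCurve (p : ℚ)).baseChange K))
      (fnB : geomTorsion ((cubeSumCurve (p : ℚ)).baseChange K) ((2 : ℕ) : ℤ) →+
        geomTorsion ((cubeSumCurve (p : ℚ)).baseChange K) ((2 : ℕ) : ℤ))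
      (hfnB : ∀ (σ : absoluteGaloisGroup K)
        (P : geomTorsion ((cubeSumCurve (p : ℚ)).baseChange K) ((2 : ℕ) : ℤ)),
        fnB (ContinuousMonoidHom.id _ σ • P) = σ • fnB P),
      (∀ P, φB (φB P) + φB P + P = 0) ∧
      (∀ (x y : AlgebraicClosure K)
        (h : (((cubeSumCurve (p : ℚ)).baseChange K).baseChange
          (AlgebraicClosure K)).toAffine.Nonsingular x y),
        ∃ h', φB (Affine.Point.some x y h) =
          Affine.Point.some (algebraMap K (AlgebraicClosure K) ω ^ 2 * x) y h') ∧
      (∀ P : geomTorsion ((cubeSumCurve (p : ℚ)).baseChange K) ((2 : ℕ) : ℤ),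
        ((fnB P : geomTorsion ((cubeSumCurve (p : ℚ)).baseChange K) ((2 : ℕ) : ℤ)) :
          geomPoints ((cubeSumCurve (p : ℚ)).baseChange K)) = φB P) ∧
      ∀ (y x₁ : galH1Torsion ((cubeSumCurve (p : ℚ)).baseChange K) ((2 : ℕ) : ℤ)),
        conjAct (cubeSumCurve (p : ℚ)) c ((2 : ℕ) : ℤ) x₁ = x₁ →
        (∃ α β : ℤ, y = α • x₁ + β • resH1Hom (ContinuousMonoidHom.id _) fnB hfnB x₁) →
        (∀ a b : ℤ, ∃ a' b' : ℤ,
          a • x₁ + b • resH1Hom (ContinuousMonoidHom.id _) fnB hfnB x₁ =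
            a' • y + b' • resH1Hom (ContinuousMonoidHom.id _) fnB hfnB y) →
        ∀ s : galH1Torsion ((cubeSumCurve (p : ℚ)).baseChange K) ((2 : ℕ) : ℤ),
          (¬ ∃ a b : ℤ, s = a • y + b • resH1Hom (ContinuousMonoidHom.id _) fnB hfnB y) →
          ∀ cl : galH1Torsion ((cubeSumCurve (3 * (p : ℚ) ^ 2)).baseChange K) ((2 : ℕ) : ℤ),
            cl ≠ 0 →
            Set.Infinite {ℓ : ℕ | (ℓ.Prime ∧ ¬ ℓ ∣ NA ∧ ¬ ℓ ∣ NB ∧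
                ¬ ((ℓ : ℤ) ∣ NumberField.discr K) ∧ ℓ ≠ 2 ∧ (Ideal.span {(ℓ : 𝓞 K)}).IsPrime ∧
                FrobEqFrobInfty (cubeSumCurve (3 * (p : ℚ) ^ 2)) K 2 ℓ ∧
                FrobEqFrobInfty (cubeSumCurve (p : ℚ)) K 2 ℓ) ∧
              ∀ v : HeightOneSpectrum (𝓞 K), (ℓ : 𝓞 K) ∈ v.asIdeal →
                y ∈ ((cubeSumCurve (p : ℚ)).baseChange K).torsionLocalKer
                  (v.adicCompletion K) ((2 : ℕ) : ℤ) ∧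
                s ∉ ((cubeSumCurve (p : ℚ)).baseChange K).torsionLocalKer
                  (v.adicCompletion K) ((2 : ℕ) : ℤ) ∧
                cl ∉ ((cubeSumCurve (3 * (p : ℚ) ^ 2)).baseChange K).torsionLocalKer
                  (v.adicCompletion K) ((2 : ℕ) : ℤ)} := by
  have hp0 : (p : ℚ) ≠ 0 := by exact_mod_cast hp.ne_zero
  have hp2 : p ≠ 2 := by rintro rfl; norm_num at hp3
  haveI := Rank1Residual.X12.CubeSumFamilies.isElliptic_cubeSumCurve hp0
  haveI := Rank1Residual.X12.CubeSumFamilies.isElliptic_cubeSumCurve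
    (mul_ne_zero (by norm_num) (pow_ne_zero 2 hp0) : (3 * (p : ℚ) ^ 2) ≠ 0)
  exact exists_cmH1_infinite_kolyvaginPrimes_line_hsy
    (JZero.isImaginaryQuadratic_of_sq_add_self_add_one hω h2)
    (JZero.exists_aut_apply_eq_sq K hω h2).1 hcω rfl rfl rfl rfl
    (forall_pow_three_add_algebraMap_a₆_three_mul_sq_ne_zero hω h2 hp hp2)
    (pow_three_add_a₆_ne_zero_of_mem_adjoin_of_prime hω h2 hp hp3) rfl rfl rfl rfl
    (forall_pow_three_add_algebraMap_a₆_ne_zero_of_prime hω h2 hp hp2)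
    (pow_three_add_a₆_ne_zero_of_mem_adjoin_of_three_mul_sq hω h2 hp hp3)

/-- `p % 9 ∈ {4, 7} ⇒ p % 3 = 1` (the route's congruence implies the Kummer lane's). [folklore] -/
theorem mod_three_eq_one_of_mod_nine {p : ℕ} (h9 : p % 9 = 4 ∨ p % 9 = 7) : p % 3 = 1 := by
  omega

/-- **(hL3a) at `p = 2` for the Sylvester pair**, keyed on the ROUTE's congruence
`p % 9 = 4 ∨ p % 9 = 7` (VARIANT K / `UpperOffV0HSYPlus`):
`infinite_kolyvaginPrimes_ne_sylvesterPair` through `p % 3 = 1`. -/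
theorem infinite_kolyvaginPrimes_ne_sylvesterPair_of_mod_nine {ω : K} (hω : ω ^ 2 + ω + 1 = 0)
    (h2 : Module.finrank ℚ K = 2) {p : ℕ} (hp : p.Prime) (h9 : p % 9 = 4 ∨ p % 9 = 7)
    {NA NB : ℕ} [NeZero NA] [NeZero NB]
    (s : galH1Torsion ((cubeSumCurve (3 * (p : ℚ) ^ 2)).baseChange K) ((2 : ℕ) : ℤ))
    (t : galH1Torsion ((cubeSumCurve (p : ℚ)).baseChange K) ((2 : ℕ) : ℤ)) :
    Set.Infinite {ℓ : ℕ | (ℓ.Prime ∧ ¬ ℓ ∣ NA ∧ ¬ ℓ ∣ NB ∧ ¬ ((ℓ : ℤ) ∣ NumberField.discr K) ∧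
        ℓ ≠ 2 ∧ (Ideal.span {(ℓ : 𝓞 K)}).IsPrime ∧
        FrobEqFrobInfty (cubeSumCurve (3 * (p : ℚ) ^ 2)) K 2 ℓ ∧
        FrobEqFrobInfty (cubeSumCurve (p : ℚ)) K 2 ℓ) ∧
      ∀ v : HeightOneSpectrum (𝓞 K), (ℓ : 𝓞 K) ∈ v.asIdeal →
        (s ≠ 0 → s ∉ ((cubeSumCurve (3 * (p : ℚ) ^ 2)).baseChange K).torsionLocalKer
          (v.adicCompletion K) ((2 : ℕ) : ℤ)) ∧
        (t ≠ 0 → t ∉ ((cubeSumCurve (p : ℚ)).baseChange K).torsionLocalKer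
          (v.adicCompletion K) ((2 : ℕ) : ℤ))} :=
  infinite_kolyvaginPrimes_ne_sylvesterPair hω h2 hp (mod_three_eq_one_of_mod_nine h9) s t

end Summit.BirchSwinnertonDyer.BirchSwinnertonDyer.Theorems.SylvesterTwoCoupledDescentCebotarev

end
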